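import Summits.HodgeConjecture.CorCM.DihedralReflexSwapReflect
import Literature.NumberTheory.ComplexMultiplication.CMTypeRankTypeConjugation
import Literature.AlgebraicGeometry.Pohlmann1968.NondegenerateCMAlgebraTypes
import HarnessLib

/-!
# The mixed dihedral pair, II: two simple CM abelian surfaces with NON-ISOMORPHIC quartic CM fields sharing their
# Galois closure form a nondegenerate pair — the Hodge conjecture for all `S^a × S′^b`

COR-CM (cell `pub-hodgecm2`, seat p2 gen 18, count-neutral claim CLOSURE-BOUND (F4b)); NEW as stated, hence under
`Summits/`.  Theorems only; no definition, no named fact, no `sorry`.  Sequel of `DihedralReflexSwapReflect` (F4a: the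
swap–reflection `g = τσ₀` and the irreducibility of `U(Ψ)`).

THE SITUATION (Shimura §8.4 Example (2)(C); Moonen–Zarhin 1999, "Hodge groups of simple abelian surfaces of CM-type").
For a non-Galois quartic CM field `K` with (dihedral octic) Galois closure `L ⊂ ℂ`, the simple CM abelian surfaces whose
Galois closure is `L` fall in four isogeny classes: two with CM by `K` (types `{a, b}`, `{a, b̄}`) and two with CM by the
other quartic CM class `M` of `L` (the reflex field `K* = ℚ(ξ + ξ^φ)`).  PAIRS from these four:
* `K`–`K` (`S₁ ≁ S₁′`, same field): nondegenerate — seat b24's `QuarticCMTypePairNondegenerate` (Moonen–Zarhin's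
  "`X₁ ≁ X₂` ⟹ `Hg(X) = Hg(X₁) × Hg(X₂)`"); structurally a TYPE-LEVEL partial conjugation (`CMTypeRankTypeConjugation` §1);
* `K`–`M` (THIS FILE): nondegenerate as well, although NO type-level partial conjugation exists for this pair; the
  mechanism is STABILISER SEPARATION (`CMTypeRankTypeConjugation` §2): the swap–reflection `g` of F4a stabilises the
  `K`-type `Φ = {a, b}` (it swaps `a ↔ b`) and moves every `M`-type (`g t₀ = t₀`, `g t₁ = t̄₁`), and `U(Ψ)` is irreducible,
  so `ext U(Ψ) ≤ U(Φ, Ψ)` and `rank(Φ, Ψ) − 1 = (rank Φ − 1) + (rank Ψ − 1) = 4`, the maximum (`rank = 5`);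
* THREE or four of them: DEGENERATE (`CMFamilyRankClosureBound.not_isNondegenerateFamily_of_quartic_of_mem_normalClosure`,
  `12 > 8`; the census `Census/DihedralSurfaceTriple`).

WHAT IS PROVED.
* **`isNondegenerateFamily_of_swap_reflect`**, **`isNondegenerateFamily_of_dihedralReflexPair`** — for a two-slot family
  `(K_{i₀}, Φ), (K_{i₁}, Ψ)` of non-Galois quartic CM fields with `Hom(K_{i₁}, ℂ)` landing in the Galois closure of `K_{i₀}`
  and `Hom(K_{i₁}, K_{i₀}) = ∅`: `CMAlgebra.IsNondegenerateFamily`, for ALL types `Φ, Ψ`;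
  `cmFamilyRank_eq_five_of_dihedralReflexPair` (the closure bound `8/2 + 1` of `CMFamilyRankClosureBound` is attained).
* Geometry (Hazama–Murty / Pohlmann, the tree's `CMAlgebra.IsNondegenerateFamily.hodgeConjectureFor_prod`):
  **`hodgeConjectureFor_prod_of_dihedralReflexPair`**, `hodgeClassSpan_prod_eq_divisorClassesSpan_of_dihedralReflexPair` —
  `B• = D•` and the Hodge conjecture on every `S^a × S′^b` (every `⨁_{k<N} A_{π k}`) for realisations `S, S′`, i.e. two
  non-isogenous simple CM abelian surfaces from the two quartic CM classes of one dihedral octic field, UNCONDITIONAL.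

## References

* [Shimura1998] G. Shimura, *Abelian Varieties with Complex Multiplication and Modular Functions*, §8.4 Example (2)(C).
* [MoonenZarhin1999LowDim] B. Moonen, Yu. Zarhin, *Hodge classes on abelian varieties of low dimension*, Math. Ann. 315
  (1999) 711–733, "Hodge groups of simple abelian surfaces of CM-type".
* [Gordon1999HodgeAVSurvey] B. B. Gordon, *A survey of the Hodge conjecture for abelian varieties*, §3, 7.5, 10.10.
-/


noncomputable section

open CategoryTheory CategoryTheory.Limits NumberField NumberField.ComplexEmbedding IntermediateField
open scoped BigOperators

namespace Summit.HodgeConjecture.CorCM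

open Literature.NumberTheory.ComplexMultiplication
open Literature.NumberTheory.ComplexMultiplication.CMTypeOps (mem_iff_conjugate_notMem conjugate_mem_iff_notMem)
open Literature.AlgebraicGeometry.Motives (AbelianVariety CMType)
open Literature.AlgebraicGeometry.HodgeTheory
open Literature.AlgebraicGeometry.ComplexMultiplication (IsCMTypeRealisation)
open Literature.AlgebraicGeometry.VanGeemen1994 (hodgeClassSpan)
open Literature.AlgebraicGeometry.Pohlmann1968
open Literature.Barriers.HodgeConjecture (divisorClassesSpan)
open QuarticCM

namespace DihedralReflexPair
/-! ### §5 The pair is nondegenerate -/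

section Family

variable {I : Type} {K : I → Type} [∀ i, Field (K i)] [∀ i, NumberField (K i)] [∀ i, IsCMField (K i)] [Fintype I]
  [DecidableEq I]

omit [∀ i, IsCMField (K i)] [DecidableEq I] in
/-- `|⊔_i Hom(K_i, ℂ)| = Σ_i [K_i : ℚ]`. [folklore] -/
private theorem card_sigma_ringHom_eq_sum₃ :
    Fintype.card ((i : I) × (K i →+* ℂ)) = ∑ i, Module.finrank ℚ (K i) := by
  rw [Fintype.card_sigma]
  exact Finset.sum_congr rfl fun i _ => Embeddings.card (K i) ℂ

/-- **A two-slot family with a swap–reflection is nondegenerate.**  Slots `i₀ ≠ i₁` with non-Galois quartic CM fields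
`K_{i₀}, K_{i₁}`; `Φ_{i₀} = {a, b}`; `g ∈ Aut(ℂ)` with `g ∘ a = b`, `g ∘ b = a` (so `g` stabilises `Φ_{i₀}`) and
`g ∘ t₀ = t₀`, `g ∘ t₁ = t̄₁` on `Hom(K_{i₁}, ℂ)` (so `g` moves EVERY type of `K_{i₁}`): stabiliser separation at `i₁`
(`CMTypeRankTypeConjugation.typeRank_sigmaType_eq_iff_forall_of_stabSep_pair`, with §4) and the nondegeneracy of both
members (`QuarticCM.isNondegenerate_of_not_isGalois`). [cite: MoonenZarhin1999LowDim, "Hodge groups of simple abelian surfaces of CM-type"]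
[cite: Gordon1999HodgeAVSurvey, 7.5] -/
theorem isNondegenerateFamily_of_swap_reflect {i₀ i₁ : I} (hI : ∀ j, j = i₀ ∨ j = i₁) (h01 : i₀ ≠ i₁)
    (h4₀ : Module.finrank ℚ (K i₀) = 4) (hK₀ : ¬IsGalois ℚ (K i₀)) (h4₁ : Module.finrank ℚ (K i₁) = 4)
    (hK₁ : ¬IsGalois ℚ (K i₁)) (Φ : ∀ i, CMType (K i)) {a b : K i₀ →+* ℂ} (hba : b ≠ a) (hba' : b ≠ conjugate a)
    (hΦ : ∀ s, s ∈ (Φ i₀).1 ↔ s = a ∨ s = b) {g : ℂ ≃+* ℂ} {t₀ t₁ : K i₁ →+* ℂ}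
    (hga : g • a = b) (hgb : g • b = a) (hg0 : g • t₀ = t₀) (hg1 : g • t₁ = conjugate t₁) :
    CMAlgebra.IsNondegenerateFamily Φ := by
  haveI : Nonempty I := ⟨i₁⟩
  have ha : a ∈ (Φ i₀).1 := (hΦ a).2 (Or.inl rfl)
  have hb : b ∈ (Φ i₀).1 := (hΦ b).2 (Or.inr rfl)
  have hna : conjugate a ∉ (Φ i₀).1 := (mem_iff_conjugate_notMem _ a).1 ha
  have hnb : conjugate b ∉ (Φ i₀).1 := (mem_iff_conjugate_notMem _ b).1 hb
  -- `g` stabilises `Φ_{i₀}`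
  have hstab : ∀ i, i ≠ i₁ → ∀ y : K i →+* ℂ, g • y ∈ (Φ i).1 ↔ y ∈ (Φ i).1 := by
    intro i hi y
    obtain rfl : i = i₀ := (hI i).resolve_right hi
    rcases eq_or_eq_or_eq_or_eq h4₀ hba hba' y with rfl | rfl | rfl | rfl
    · rw [hga]; exact iff_of_true hb ha
    · rw [smul_conjugate, hga]; exact iff_of_false hnb hna
    · rw [hgb]; exact iff_of_true ha hb
    · rw [smul_conjugate, hgb]; exact iff_of_false hna hnb
  -- `g` moves `Φ_{i₁}`
  have hmove : ∃ y : K i₁ →+* ℂ, ¬(g • y ∈ (Φ i₁).1 ↔ y ∈ (Φ i₁).1) := by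
    by_cases ht : t₁ ∈ (Φ i₁).1
    · refine ⟨t₁, fun h => ?_⟩
      rw [hg1] at h
      exact (mem_iff_conjugate_notMem _ t₁).1 ht (h.2 ht)
    · refine ⟨conjugate t₁, fun h => ?_⟩
      rw [smul_conjugate, hg1, involutive_conjugate] at h
      exact ht (h.2 ((conjugate_mem_iff_notMem _ t₁).2 ht))
  have key := typeRank_sigmaType_eq_iff_forall_of_stabSep_pair (G := ℂ ≃+* ℂ) (Φ := fun i => (Φ i).1) i₁
    (fun i => isCMTypeWith_conj (Φ i)) hI h01 hstab hmove (antiSpan_eq_of_stable h4₁ hK₁ (Φ i₁))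
  rw [CMAlgebra.isNondegenerateFamily_iff, ← card_sigma_ringHom_eq_sum₃ (K := K)]
  refine key.2 fun i => ?_
  have hnd : IsNondegenerate (Φ i) := by
    rcases hI i with rfl | rfl
    · exact isNondegenerate_of_not_isGalois h4₀ hK₀ (Φ _)
    · exact isNondegenerate_of_not_isGalois h4₁ hK₁ (Φ _)
  rw [isNondegenerate_iff, cmTypeRank, ← Embeddings.card (K i) ℂ] at hnd
  exact hnd

/-- **The mixed dihedral pair is nondegenerate.**  Let `K_{i₀}`, `K_{i₁}` be NON-GALOIS quartic CM fields such that every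
complex embedding of `K_{i₁}` lands in the Galois closure of `K_{i₀}` and `K_{i₁}` does NOT embed into `K_{i₀}` (so
`K_{i₁}` is the other quartic CM class of the common dihedral closure — the reflex class).  Then EVERY two-slot family of
CM types `(Φ_{i₀}, Φ_{i₁})` is nondegenerate (rank `5`): the products `S^a × S′^b` of the corresponding simple CM abelian
surfaces are stably nondegenerate — Moonen–Zarhin's Proposition for `X₁ ≁ X₂` with different (but Galois-equivalent)
CM fields, in Hazama–Murty's rank form. [cite: MoonenZarhin1999LowDim, "Hodge groups of simple abelian surfaces of CM-type"]
[cite: Shimura1998, §8.4 Example (2)(C)] -/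
theorem isNondegenerateFamily_of_dihedralReflexPair {i₀ i₁ : I} (hI : ∀ j, j = i₀ ∨ j = i₁) (h01 : i₀ ≠ i₁)
    (h4₀ : Module.finrank ℚ (K i₀) = 4) (hK₀ : ¬IsGalois ℚ (K i₀)) (h4₁ : Module.finrank ℚ (K i₁) = 4)
    (hK₁ : ¬IsGalois ℚ (K i₁)) (hMK : ∀ (t : K i₁ →+* ℂ) (y : K i₁), t y ∈ normalClosure ℚ (K i₀) ℂ)
    (hne : IsEmpty (K i₁ →+* K i₀)) (Φ : ∀ i, CMType (K i)) : CMAlgebra.IsNondegenerateFamily Φ := by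
  obtain ⟨a, b, hba, hba', hΦ⟩ := exists_mem_mem_ne h4₀ (Φ i₀)
  obtain ⟨g, t₀, t₁, -, -, hga, hgb, hg0, hg1⟩ := exists_swap_reflect h4₀ hK₀ h4₁ hMK hne hba hba'
  exact isNondegenerateFamily_of_swap_reflect hI h01 h4₀ hK₀ h4₁ hK₁ Φ hba hba' hΦ hga hgb hg0 hg1

/-- **Rank `5`**: `cmFamilyRank (Φ_{i₀}, Φ_{i₁}) = 5 = (4 + 4)/2 + 1` for the mixed dihedral pair (`dim MT(S × S′) = 5`,
the dimension of the Serre group of the octic closure: the closure bound `CMFamilyRankClosureBound` is attained).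
[cite: MoonenZarhin1999LowDim, "Hodge groups of simple abelian surfaces of CM-type"] -/
theorem cmFamilyRank_eq_five_of_dihedralReflexPair {i₀ i₁ : I} (hI : ∀ j, j = i₀ ∨ j = i₁) (h01 : i₀ ≠ i₁)
    (h4₀ : Module.finrank ℚ (K i₀) = 4) (hK₀ : ¬IsGalois ℚ (K i₀)) (h4₁ : Module.finrank ℚ (K i₁) = 4)
    (hK₁ : ¬IsGalois ℚ (K i₁)) (hMK : ∀ (t : K i₁ →+* ℂ) (y : K i₁), t y ∈ normalClosure ℚ (K i₀) ℂ)
    (hne : IsEmpty (K i₁ →+* K i₀)) (Φ : ∀ i, CMType (K i)) : CMAlgebra.cmFamilyRank Φ = 5 := by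
  have h := isNondegenerateFamily_of_dihedralReflexPair hI h01 h4₀ hK₀ h4₁ hK₁ hMK hne Φ
  have hsum : ∑ i, Module.finrank ℚ (K i) = 8 := by
    rw [Fintype.sum_eq_add i₀ i₁ h01 fun j hj => by
      rcases hI j with rfl | rfl
      · exact absurd rfl hj.1
      · exact absurd rfl hj.2, h4₀, h4₁]
  rw [CMAlgebra.isNondegenerateFamily_iff, hsum] at h
  omega

end Family

end DihedralReflexPair

/-! ### §6 Geometry: the Hodge conjecture on `S^a × S′^b` -/

section Geometry

variable {I : Type} {K : I → Type} [∀ i, Field (K i)] [∀ i, NumberField (K i)] [∀ i, IsCMField (K i)] [Fintype I]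
  [Nonempty I] {Φ : ∀ i, CMType (K i)}
variable {A : I → AbelianVariety ℂ} {ι : ∀ i, 𝓞 (K i) →+* End (A i)}
  {θ : ∀ i, K i →+* Module.End ℂ (complexBetti (A i).X 1)}

/-- **`B• = D•` on every `S^a × S′^b`** for realisations `S = A_{i₀}`, `S′ = A_{i₁}` of CM types of the two quartic CM
classes `K_{i₀} ≇ K_{i₁}` of one dihedral octic field: every rational `(m,m)` class on every product `⨁_{j<N} A_{π j}` is a
polynomial in divisor classes (Hazama–Murty for the nondegenerate pair). [cite: Gordon1999HodgeAVSurvey, 7.5 and 10.10]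
[cite: MoonenZarhin1999LowDim, "Hodge groups of simple abelian surfaces of CM-type"] -/
theorem hodgeClassSpan_prod_eq_divisorClassesSpan_of_dihedralReflexPair {i₀ i₁ : I} (hI : ∀ j, j = i₀ ∨ j = i₁)
    (h01 : i₀ ≠ i₁) (h4₀ : Module.finrank ℚ (K i₀) = 4) (hK₀ : ¬IsGalois ℚ (K i₀))
    (h4₁ : Module.finrank ℚ (K i₁) = 4) (hK₁ : ¬IsGalois ℚ (K i₁))
    (hMK : ∀ (t : K i₁ →+* ℂ) (y : K i₁), t y ∈ normalClosure ℚ (K i₀) ℂ) (hne : IsEmpty (K i₁ →+* K i₀))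
    (hA : ∀ i, IsCMTypeRealisation (Φ i) (A i) (ι i) (θ i)) {N : ℕ} (π : Fin N → I) (m : ℕ) :
    hodgeClassSpan (⨁ fun j : Fin N => A (π j)).dim (⨁ fun j : Fin N => A (π j)).X m =
      divisorClassesSpan (⨁ fun j : Fin N => A (π j)).X (⨁ fun j : Fin N => A (π j)).dim m := by
  classical
  exact (DihedralReflexPair.isNondegenerateFamily_of_dihedralReflexPair hI h01 h4₀ hK₀ h4₁ hK₁ hMK hne
    Φ).hodgeClassSpan_prod_eq_divisorClassesSpan hA π m

/-- **The Hodge conjecture for every `S^a × S′^b`** (every `⨁_{k<N} A_{π k}`), where `S, S′` realise CM types of two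
NON-ISOMORPHIC non-Galois quartic CM fields `K_{i₀}, K_{i₁}` with `Hom(K_{i₁}, ℂ)` inside the Galois closure of `K_{i₀}`
— two non-isogenous simple CM abelian surfaces from the two quartic CM classes of one dihedral octic field (e.g. a field and
its reflex field) — UNCONDITIONAL, no named fact. [cite: Gordon1999HodgeAVSurvey, 10.10 and 7.5]
[cite: MoonenZarhin1999LowDim, "Hodge groups of simple abelian surfaces of CM-type"] -/
theorem hodgeConjectureFor_prod_of_dihedralReflexPair {i₀ i₁ : I} (hI : ∀ j, j = i₀ ∨ j = i₁) (h01 : i₀ ≠ i₁)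
    (h4₀ : Module.finrank ℚ (K i₀) = 4) (hK₀ : ¬IsGalois ℚ (K i₀)) (h4₁ : Module.finrank ℚ (K i₁) = 4)
    (hK₁ : ¬IsGalois ℚ (K i₁)) (hMK : ∀ (t : K i₁ →+* ℂ) (y : K i₁), t y ∈ normalClosure ℚ (K i₀) ℂ)
    (hne : IsEmpty (K i₁ →+* K i₀)) (hA : ∀ i, IsCMTypeRealisation (Φ i) (A i) (ι i) (θ i)) {N : ℕ}
    (π : Fin N → I) : HodgeConjectureFor (⨁ fun j : Fin N => A (π j)).dim (⨁ fun j : Fin N => A (π j)).X := by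
  classical
  exact (DihedralReflexPair.isNondegenerateFamily_of_dihedralReflexPair hI h01 h4₀ hK₀ h4₁ hK₁ hMK hne
    Φ).hodgeConjectureFor_prod hA π

end Geometry

end Summit.HodgeConjecture.CorCM

end
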